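import Summits.HodgeConjecture.HodgeConjecture.Theorems.HodgeLocusCensusSchema
import HarnessLib
import HarnessLib.Audit.Tags
/-!
# HodgeLocusCensusQuarticRows — the quartic λ = −1 rows (6,4,1) and (8,4,2) of the Hodge-locus census (cell pub-hlocus, referee gen 8, REFEREE.md R17)
HONEST FRAMING: certified instances and evidence bearing on the general Hodge conjecture; no claim.

Rows (n,4,m) with m = n/2 − 2: the two k-planes P, P̌ of the Fermat quartic n-fold share k−1 coordinate pairs and are twisted in the
remaining two, so P ∩ P̌ = P^{k−2}; class δ = [P] − [P̌]. Movasati arXiv:1602.06607 §6 five-tuples (6,4,1 | 36, 37) and (8,4,2 | 83, 84)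
list these ranks with first-order excess 1. The explaining family is the Kloosterman arXiv:2312.12363 Prop 6.1 degeneration with k−1
shared linear slots, a complete intersection of type (2,2,1^{k−1}) of dimension k; the referee certificate of R17 (incidence-tangent
ranks 294 = 330 − 36 and 632 = 715 − 83 at two primes, three deformation parameters, two or three twist pairs; flat limit P ∪ three
k-planes with the class of δ) gives the dimension statement: V_δ is smooth reduced of codimension 36 resp. 83 through Fermat.
Only the RANK is typed here; the geometric identification is the cited evidence (COMPONENTS.md). The ranks 36 and 83 were computed by
two implementations (period matrix modulo two primes; Jacobian-ring colon ideal exactly over the cyclotomic field).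
-/
namespace Summit.HodgeConjecture.HodgeConjecture.HodgeLocus.Census

/-- (6,4,1 | 36, 37): rank 36 for δ = [P] − [P̌], P ∩ P̌ = P^1 in the Fermat quartic sixfold; EXPLAINED-SMOOTH with the R17 dimension
certificate (rank dΦ = 294 = 330 − 36; cycles: P ∪ P̌ or a (2,2,1,1) complete-intersection threefold). OPEN in Lean. -/
@[conjecture] def explainedSmooth_6_4_1_difference : Prop :=
  ExplainedSmoothRow 6 4 36 [(1, standardP 6), (-1, standardPc 6 1 1)]

/-- (8,4,2 | 83, 84): rank 83 for δ = [P] − [P̌], P ∩ P̌ = P^2 in the Fermat quartic eightfold; EXPLAINED-SMOOTH with the R17 dimension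
certificate (rank dΦ = 632 = 715 − 83; family CI(2,2,1,1,1)). OPEN in Lean. -/
@[conjecture] def explainedSmooth_8_4_2_difference : Prop :=
  ExplainedSmoothRow 8 4 83 [(1, standardP 8), (-1, standardPc 8 2 1)]

set_option maxRecDepth 20000 in
/-- the (6,4) matrix is square: rows |I_4| = 266 (k·d − n − 2 = 4 = d), columns |I_4| = 266 (engine R matrix shape 266 × 266). -/
theorem card_indexSet_6_4 : (indexSet 6 4 4).card = 266 := by decide +kernel

set_option maxRecDepth 20000 in
/-- rows of degree 1: |I_1| = 8 (one index per variable of the Fermat quartic sixfold). -/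
theorem card_indexSet_6_4_deg1 : (indexSet 6 4 1).card = 8 := by decide +kernel

end Summit.HodgeConjecture.HodgeConjecture.HodgeLocus.Census
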